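import Summits.BirchSwinnertonDyer.BirchSwinnertonDyer.Theorems.KolyvaginRoadThreeMethod2KolyvaginLocalFrobenius
import Summits.BirchSwinnertonDyer.BirchSwinnertonDyer.Theorems.KolyvaginRoadThreeMethod2LevelSystems
import Summits.BirchSwinnertonDyer.Rank1Residual.GaloisImage.TransverseCupProductVanishing
import Summits.BirchSwinnertonDyer.Rank1Residual.X11b.KolyvaginH44ConcreteData
import Literature.NumberTheory.EllipticCurves.WeilPairingTateDual
import Literature.NumberTheory.EllipticCurves.RingClassGalOverCyclicProofs
import HarnessLib

/-!
# KOLY method line, crux stmt-BirchSwinnertonDyer-19574 `ZhangSharpFrameAtThreeHL`, stub S2-ENGINE: (Tr-iso) — THE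
# TRANSVERSE CONDITION AT A KOLYVAGIN PRIME IS ISOTROPIC for the local Weil cup product
# (cell `bsd-stepL`, seat `bsd-stepL-zhang3-p1` g9; `--supports 19574`, helper; discharges the binder `hisoTr` of
# `Method2.triangulation_of_kolyvaginLocal`)

HONEST FRAMING. Theorems only (0 definitions, 0 named facts, 0 `sorry`); closes nothing (T7). PARTITION: O2@3 (B10) ×
A1 × crux 19574 × stub S2-ENGINE — types-the-object-of (one input of the Kolyvagin-prime local package PROVED).

WHAT. `Method2.KolyLocal.cupProduct_eq_zero_of_mem_transverseLocalKer`: at an HL-type frame (`K` imaginary quadratic),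
for a Kolyvagin prime `ℓ` of W. Zhang at `p = 3`, its place `λ ∋ ℓ`, EVERY `Γ_K`-equivariant bi-additive `μ₃`-valued
pairing `e` on `E[3]`, and two classes `x, y ∈ H¹(K, E[3])` in the TRANSVERSE condition `Method2.transverseLocalKer W K ι
ℓ λ` (W. Zhang §8.1 `H¹_tr`: cocycle vanishing on `G_𝔓 ∩ Gal(K̄/K[ℓ])`), the local Weil cup product of the localisations
vanishes: `loc_λ x ∪ₑ loc_λ y = 0` in `H²(K_λ, μ₃)`. Proof (Mazur–Rubin Prop. 1.3.2 (ii) mechanism at odd exponent, tree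
`TransverseCup.cupClass_eq_zero_of_fixed_of_cyclic`, n1011): on `Γ_{K_λ}` (`= G_𝔓`, Neukirch II (9.6)) the two cocycles
are homomorphisms with `Γ_{K_λ}`-FIXED values (`G_𝔓` acts trivially on `E[3]`, `KolyLocal.decompositionSubgroup_le_
torsionFixing`) vanishing on the kernel of the restriction `χ : Γ_{K_λ} → Gal(K[ℓ]/K)` (transversality; the restriction
`KolyvaginH44.exists_absGaloisRestrict`, normality of `K[ℓ]/K` to pass between `K`-embeddings), whose image lies in
`G_ℓ = Gal(K[ℓ]/K[1])` (`G_𝔓` fixes `K[1]`, `KolyLocal.smul_ringClassFieldOne_eq_self_of_mem_decompositionSubgroup`) —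
a CYCLIC group (Gross §3, tree `isCyclic_ringClassGalOver`) — so the cup-product cochain is symmetric and, `3` being odd,
a coboundary.

References: [cite: WZhang2014, §8.1 (H¹_tr), Lemma 8.4] [cite: MazurRubin2004, Prop. 1.3.2 (ii)] [cite: GrossLMS1991,
§3–§4] [cite: NeukirchANT1999, Ch. II §9 Prop. (9.6)].
-/

noncomputable section

open scoped Classical Pointwise

namespace Summit.BirchSwinnertonDyer.Rank1Residual.X11b.Three.Koly.Method2.KolyLocal

open CategoryTheory WeierstrassCurve Field Function NumberField IsDedekindDomain
open Literature.NumberTheory.EllipticCurves Literature.NumberTheory.EllipticCurves.ModularForms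
  Literature.NumberTheory.GaloisRepresentations Module
open Literature.NumberTheory.GaloisRepresentations.DiscreteGaloisModule (mu MuCarrier)
open Literature.NumberTheory.GaloisCohomology
open Summit.BirchSwinnertonDyer.Rank1Residual.X11b.Three.Koly.Method2
open Summit.BirchSwinnertonDyer.Rank1Residual.GaloisImage
open scoped ContRepresentation

-- Cup products need `LocallyCompactSpace Γ`; as in the tree's cup-product files, the compactness of
-- absolute Galois groups is a local instance only; `E[n]` finite for the Tate-dual bookkeeping.
attribute [local instance] absoluteGaloisGroup_compactSpace
attribute [local instance] finite_geomTorsion_of_neZero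

variable (W : WeierstrassCurve ℚ) (K : Type) [Field K] [NumberField K] [W.IsElliptic] [W.IsGloballyMinimal]

/-- **Transversality passes between `K`-embeddings of `K[ℓ]`**: an element of `Γ_K` fixing ONE `K`-embedded copy of the
normal extension `K[ℓ]/K` fixes all of them (they have the same image: `AlgHom.restrictNormal`). [folklore] -/
theorem mem_ringClassStabilizer_of_forall_smul_eq (hK : IsImaginaryQuadratic K) (ι : K →+* ℂ) {n : ℕ} (hn : n ≠ 0)
    (e : ringClassField K ι n →ₐ[K] AlgebraicClosure K) {γ : absoluteGaloisGroup K}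
    (hγ : ∀ x, γ • e x = e x) : γ ∈ ringClassStabilizer K ι n n := by
  haveI := (finiteDimensional_and_isGalois_ringClassField hK ι hn).1
  haveI := (finiteDimensional_and_isGalois_ringClassField hK ι hn).2
  rw [mem_ringClassStabilizer_iff]
  intro e' x _
  letI : Algebra (ringClassField K ι n) (AlgebraicClosure K) := e.toRingHom.toAlgebra
  haveI : IsScalarTower K (ringClassField K ι n) (AlgebraicClosure K) :=
    IsScalarTower.of_algebraMap_eq fun k ↦ (e.commutes k).symm
  have h := AlgHom.restrictNormal_commutes e' (ringClassField K ι n) x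
  -- `e (s x) = e' x` with `s = e'.restrictNormal K[n]`
  change e (e'.restrictNormal (ringClassField K ι n) x) = e' (algebraMap _ _ x) at h
  rw [Algebra.algebraMap_self, RingHom.id_apply] at h
  rw [← h, hγ]

/-- **(Tr-iso): the transverse condition at a Kolyvagin prime is isotropic for the local Weil cup product.** See the
module docstring. `K` imaginary quadratic, `ι : K → ℂ`, `ℓ` a Kolyvagin prime of W. Zhang at `3`, `v ∋ ℓ` its place,
`e` any `Γ_K`-equivariant bi-additive `μ₃`-valued pairing on `E[3]`; for `x, y ∈ Method2.transverseLocalKer W K ι ℓ v`,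
`loc_v x ∪ₑ loc_v y = 0` in `H²(K_v, μ₃)`. [cite: WZhang2014, §8.1 (H¹_tr), Lemma 8.4 (proof)]
[cite: MazurRubin2004, Prop. 1.3.2 (ii)] [cite: GrossLMS1991, §3–§4] -/
theorem cupProduct_eq_zero_of_mem_transverseLocalKer (hK : IsImaginaryQuadratic K) (ι : K →+* ℂ)
    (e : geomTorsion (W.baseChange K) ((3 ^ 1 : ℕ) : ℤ) → geomTorsion (W.baseChange K) ((3 ^ 1 : ℕ) : ℤ) →
      AlgebraicClosure K)
    (hμ : ∀ P Q, e P Q ^ (3 ^ 1) = 1) (hadd₁ : ∀ P₁ P₂ Q, e (P₁ + P₂) Q = e P₁ Q * e P₂ Q)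
    (hadd₂ : ∀ P Q₁ Q₂, e P (Q₁ + Q₂) = e P Q₁ * e P Q₂)
    (hgal : ∀ (σ : absoluteGaloisGroup K) (P Q : geomTorsion (W.baseChange K) ((3 ^ 1 : ℕ) : ℤ)),
      σ • e P Q = e (σ • P) (σ • Q))
    {ℓ : ℕ} (hℓ : Zhang2014.IsKolyvaginPrime (W.conductorNorm ℤ) W K 3 ℓ) (v : HeightOneSpectrum (𝓞 K))
    (hv : (ℓ : 𝓞 K) ∈ v.asIdeal) {x y : V3 W K} (hx : x ∈ transverseLocalKer W K ι ℓ v)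
    (hy : y ∈ transverseLocalKer W K ι ℓ v) :
    (weilContPairingLocal (W.baseChange K) (3 ^ 1) e hμ hadd₁ hadd₂ hgal (Sum.inr v)).cupProduct
      (galoisCohomology.localization ((W.baseChange K).torsionGaloisModule ((3 ^ 1 : ℕ) : ℤ)) (Sum.inr v) 1 x)
      (galoisCohomology.localization ((W.baseChange K).torsionGaloisModule ((3 ^ 1 : ℕ) : ℤ)) (Sum.inr v) 1 y) = 0 := by
  haveI : NeZero (3 ^ 1 : ℕ) := ⟨by norm_num⟩
  have hℓp : ℓ.Prime := hℓ.1
  have hℓ0 : ℓ ≠ 0 := hℓp.ne_zero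
  have hℓP : (Ideal.span {(ℓ : 𝓞 K)}).IsPrime := hℓ.2.2.2.2.1
  haveI := (finiteDimensional_and_isGalois_ringClassField hK ι hℓ0).1
  haveI := (finiteDimensional_and_isGalois_ringClassField hK ι hℓ0).2
  haveI := (finiteDimensional_and_isGalois_ringClassField hK ι one_ne_zero).1
  haveI : FiniteDimensional ℚ (ringClassField K ι ℓ) := Module.Finite.trans K (ringClassField K ι ℓ)
  set Kv := v.adicCompletion K with hKv
  set ι₀ := closureEmb (K := K) Kv with hι₀
  obtain ⟨𝔐, h𝔐⟩ := v.localPrimesAbove_nonempty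
  set 𝔓 := v.primeBelow ι₀ 𝔐 with h𝔓def
  have h𝔓 : 𝔓 ∈ v.primesAbove := HeightOneSpectrum.primeBelow_mem_primesAbove h𝔐
  -- `res Γ_{K_v} ⊆ G_𝔓 ⊆ Γ_{K(E[3])}`
  have hres : ∀ s : absoluteGaloisGroup Kv,
      absGaloisRestrict K Kv s ∈ 𝔓.decompositionSubgroup (absoluteGaloisGroup K) := fun s ↦ by
    rw [← resGal_eq_absGaloisRestrict, resGal_eq]
    exact resGalOfEmb_mem_decompositionSubgroup ι₀ h𝔐 s
  have hfix : ∀ (s : absoluteGaloisGroup Kv) (Q : geomTorsion (W.baseChange K) ((3 ^ 1 : ℕ) : ℤ)),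
      absGaloisRestrict K Kv s • Q = Q := fun s Q ↦
    smul_torsion_eq_self_of_mem_decompositionSubgroup W K hK hℓ v hv h𝔐 (hres s) Q
  have htf : ∀ s : absoluteGaloisGroup Kv,
      absGaloisRestrict K Kv s ∈ torsionFixing (W.baseChange K) ((3 ^ 1 : ℕ) : ℤ) := fun s ↦
    decompositionSubgroup_le_torsionFixing W K hK hℓ v hv h𝔐 (hres s)
  -- the restriction `χ : Γ_{K_v} → Gal(K[ℓ]/K)` along a `K`-embedding `e₀ : K[ℓ] → K̄`
  let e₀ : ringClassField K ι ℓ →ₐ[K] AlgebraicClosure K := IsAlgClosed.lift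
  obtain ⟨π, hπ⟩ := KolyvaginH44.exists_absGaloisRestrict hK ι ℓ e₀
  let χ : absoluteGaloisGroup Kv →* ringClassGal ι ℓ := π.comp (absGaloisRestrict K Kv).toMonoidHom
  have hχ : ∀ s, χ s = π (absGaloisRestrict K Kv s) := fun _ ↦ rfl
  -- `ker χ ⊆` the stabiliser of `K[ℓ]` (all embeddings)
  have hker : ∀ s, χ s = 1 → absGaloisRestrict K Kv s ∈ ringClassStabilizer K ι ℓ ℓ := by
    intro s hs
    refine mem_ringClassStabilizer_of_forall_smul_eq K hK ι hℓ0 e₀ fun z ↦ ?_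
    rw [hπ, ← hχ, hs, OneMemClass.coe_one, AlgEquiv.one_apply]
  -- the image of `χ` lies in `G_ℓ = Gal(K[ℓ]/K[1])`, a cyclic group
  have h1ℓ : ringClassField K ι 1 ≤ ringClassField K ι ℓ := ringClassField_mono hK ι (one_dvd ℓ) hℓ0
  have himg : ∀ s, ((χ s : ringClassGal ι ℓ) : ringClassField K ι ℓ ≃ₐ[ℚ] ringClassField K ι ℓ) ∈
      ringClassGalOver ι ℓ 1 := by
    intro s
    rw [ringClassGalOver, mem_fixingSubgroup_iff]
    intro z hz
    rw [AlgEquiv.smul_def]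
    -- `z ∈ K[ℓ]` with `(z : ℂ) ∈ K[1]` comes from `K[1]`
    obtain ⟨z₁, hz₁⟩ : ∃ z₁ : ringClassField K ι 1, RingClassField.inclusion ι h1ℓ z₁ = z :=
      ⟨⟨(z : ℂ), hz⟩, Subtype.ext (RingClassField.coe_inclusion ι h1ℓ _)⟩
    have key : e₀ (((χ s : ringClassGal ι ℓ) : ringClassField K ι ℓ ≃ₐ[ℚ] ringClassField K ι ℓ) z) = e₀ z := by
      rw [hχ, ← hπ, ← hz₁]
      exact smul_ringClassFieldOne_eq_self_of_mem_decompositionSubgroup W K hK ι hℓ v hv h𝔓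
        (e₀.comp (RingClassField.inclusion ι h1ℓ)) (hres s) z₁
    exact e₀.injective key
  have hcycG : IsCyclic (ringClassGalOver ι ℓ 1) := by
    have h := RingClassGalOverCyclic.isCyclic_ringClassGalOver hK ι (ℓ := ℓ) (m' := 1) one_ne_zero hℓp
      (fun h ↦ hℓp.one_lt.ne' (Nat.dvd_one.mp h)) hℓP
    rwa [Nat.mul_one] at h
  have hcyc : ∃ σ : absoluteGaloisGroup Kv, ∀ s, ∃ i : ℕ, χ s = χ σ ^ i := by
    -- `χ` corestricted to the cyclic `G_ℓ`
    let ψ : absoluteGaloisGroup Kv →* ringClassGalOver ι ℓ 1 :=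
      ((ringClassGal ι ℓ).subtype.comp χ).codRestrict (ringClassGalOver ι ℓ 1) (fun s ↦ himg s)
    have hψ : ∀ s, ((ψ s : ringClassGalOver ι ℓ 1) : ringClassField K ι ℓ ≃ₐ[ℚ] ringClassField K ι ℓ) =
        (χ s : ringClassField K ι ℓ ≃ₐ[ℚ] ringClassField K ι ℓ) := fun _ ↦ rfl
    haveI : IsCyclic ψ.range := isCyclic_of_injective ψ.range.subtype ψ.range.subtype_injective
    obtain ⟨g₀, hg₀⟩ := IsCyclic.exists_monoid_generator (α := ψ.range)
    obtain ⟨σ, hσ⟩ := MonoidHom.mem_range.mp g₀.2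
    refine ⟨σ, fun s ↦ ?_⟩
    obtain ⟨i, hi⟩ := (Submonoid.mem_powers_iff _ _).mp (hg₀ ⟨ψ s, ⟨s, rfl⟩⟩)
    refine ⟨i, Subtype.ext ?_⟩
    have h1 : ((g₀ ^ i : ψ.range) : ringClassGalOver ι ℓ 1) = ψ s := congrArg Subtype.val hi
    rw [SubmonoidClass.coe_pow, ← hσ] at h1
    have h2 := congrArg (fun t : ringClassGalOver ι ℓ 1 ↦ (t : ringClassField K ι ℓ ≃ₐ[ℚ] ringClassField K ι ℓ))
      h1
    simp only [SubmonoidClass.coe_pow, hψ] at h2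
    rw [SubmonoidClass.coe_pow]
    exact h2.symm
  -- the classes as explicit cocycles on `Γ_{K_v}`
  set φx := reprCocycle (W.baseChange K) ((3 ^ 1 : ℕ) : ℤ) x with hφx
  set φy := reprCocycle (W.baseChange K) ((3 ^ 1 : ℕ) : ℤ) y with hφy
  rw [← oneCocycleClass_reprCocycle (W.baseChange K) ((3 ^ 1 : ℕ) : ℤ) x,
    ← oneCocycleClass_reprCocycle (W.baseChange K) ((3 ^ 1 : ℕ) : ℤ) y]
  change (weilContPairingLocal (W.baseChange K) (3 ^ 1) e hμ hadd₁ hadd₂ hgal (Sum.inr v)).cupProduct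
      (galoisCohomology.res ((W.baseChange K).torsionGaloisModule ((3 ^ 1 : ℕ) : ℤ)) Kv 1
        (oneCocycleClass (discreteTopRep (absoluteGaloisGroup K) (geomTorsion (W.baseChange K) ((3 ^ 1 : ℕ) : ℤ)))
          φx))
      (galoisCohomology.res ((W.baseChange K).torsionGaloisModule ((3 ^ 1 : ℕ) : ℤ)) Kv 1
        (oneCocycleClass (discreteTopRep (absoluteGaloisGroup K) (geomTorsion (W.baseChange K) ((3 ^ 1 : ℕ) : ℤ)))
          φy)) = 0
  rw [res_torsionGaloisModule_oneCocycleClass (W.baseChange K) ((3 ^ 1 : ℕ) : ℤ) Kv φx,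
    res_torsionGaloisModule_oneCocycleClass (W.baseChange K) ((3 ^ 1 : ℕ) : ℤ) Kv φy]
  erw [ContPairing.cupProduct_oneCocycleClass]
  -- the Mazur–Rubin mechanism on the cyclic quotient, exponent `3 = 2·1+1`
  refine TransverseCup.cupClass_eq_zero_of_fixed_of_cyclic _ χ _ _ (fun s t ↦ ?_) (fun s t ↦ ?_)
    (fun s hs ↦ ?_) (fun s hs ↦ ?_) hcyc 1 (fun z ↦ ?_)
  · -- values fixed (`G_𝔓` acts trivially on `E[3]`)
    rw [contOneCocycles.pullback_apply]
    exact hfix t _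
  · rw [contOneCocycles.pullback_apply]
    exact hfix t _
  · -- vanishing on `ker χ`: transversality of `x`
    rw [contOneCocycles.pullback_apply]
    change φx.1 (absGaloisRestrict K Kv s) = 0
    exact (mem_transverseLocalKer_iff.mp hx) 𝔓 h𝔓 _ (hres s) (hker s hs) (htf s)
  · rw [contOneCocycles.pullback_apply]
    change φy.1 (absGaloisRestrict K Kv s) = 0
    exact (mem_transverseLocalKer_iff.mp hy) 𝔓 h𝔓 _ (hres s) (hker s hs) (htf s)
  · -- `3 • μ₃ = 0`
    have h3 : (2 * 1 + 1) • z = ((3 ^ 1 : ℕ) : ℤ) • z := by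
      rw [← natCast_zsmul]; norm_num
    rw [h3]
    exact zsmul_muCarrier_eq_zero K (3 ^ 1) z

end Summit.BirchSwinnertonDyer.Rank1Residual.X11b.Three.Koly.Method2.KolyLocal

end
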